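import Mathlib
import Literature.NumberTheory.LFunctions.Zhang2022.SkeletonPartThree
import Literature.NumberTheory.LFunctions.MertensElementary
import Literature.NumberTheory.LFunctions.SelbergPrimeSumEstimates
import HarnessLib

/-!
# Zhang (2022) §17 p. 98 (u021, remainder `R₁`): the split-prime Euler product is `O(𝔞 + 1)` under (A)

Topic `Literature/NumberTheory/LFunctions/Zhang2022` (Landau–Siegel audit tree; verdict-neutral).
Y. Zhang, *Discrete mean estimates and the Landau–Siegel zero*, arXiv:2211.02515v1 (2022)
[Zhang2022LandauSiegel] — **an unrefereed manuscript under adjudication; nothing in this file asserts or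
denies its Theorems 1–2, and no claim about Landau–Siegel zeros is made.** ZHANG-L discharge lane, WP16
helper under the leaf `Typed.Section17.Eq17_9RelE` (sub-leaf R₁-χ of `Z22:§17.u021`, ruling RT16-int-4:
the `m₂ ≥ 2` remainder of §17.u021 is admissible in the RELATIVE currency `≤ ε·(𝔞 + 1)`).

WHY. Every majorant assembly of the §17.u021 remainders runs, after the multiplicative bookkeeping in
`m₁, m₂`, into an outer count `Σ_{l<D⁴} ν(l)/l · (τ₂ ∗ H)(l)` whose Hall–Tenenbaum bound is a product over
the primes `p < D⁴` with `χ(p) = 1` of factors `1 + 4k/p` (`ν(p) = 1 + χ(p) = 2` there, `0` at `χ(p) = −1`);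
such products are NOT `O(1)` — under (A) nothing forces few split primes below `D⁴` — but they are
controlled by the main constant `𝔞` of the leaf itself: THIS FILE proves

  `∏_{p < D⁴, χ(p) = 1} (1 + 4/p) ≤ C·(𝔞 + 1)`  for all large `D` under (A)  (`prod_splitPrimes_le_frakA`),

with an absolute `C` (here `C = 2·20⁴·e⁴`). Mechanism: for square-free `l` composed of split primes,
`ν(l)² = 4^{ω(l)}`, so Lemma 17.1 (tree theorem `Skeleton.appBLemma171_holds`: `Σ_{n<D⁴} ν(n)²/n = 𝔞 +
O(𝓛⁻²⁰¹¹)`) bounds `Σ_{T ⊆ S} 4^{|T|}/∏T` over square-free products `< D⁴` of split primes `p ≤ D^{1/5}`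
(set `S`); Rankin's trick at `σ = 5/log D` (tail `≤ e⁻²⁰·e¹⁸ ∏_{p∈S}(1+4/p)`, via Mertens I
`MertensBound.sum_log_div_prime_le`) shows that sum is `≥ ½∏_{p∈S}(1 + 4/p)`; the primes in
`(D^{1/5}, D⁴)` contribute `≤ exp(4(log 20 + 1))` by the tree's windowed Mertens II
(`SelbergPrimes.sum_inv_primes_window_le`). Powers of the statement handle the weights `8, 12, …`
(`(1 + 8/p) ≤ (1 + 4/p)²`).

Theorems only; no definitions, no named facts; standard axioms.

## References

* Y. Zhang, arXiv:2211.02515v1 (2022), §17 p. 98 (u021), Lemma 17.1 p. 96; §2 (2.31).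
  [cite: Zhang2022LandauSiegel, §17 u021 p.98]
* H. L. Montgomery, R. C. Vaughan, *Multiplicative Number Theory I*, CUP 2007, §7.1 (Rankin's method).
  [cite: MontgomeryVaughan2007, §7.1]
-/

noncomputable section

open Real Finset

namespace Literature.NumberTheory.LFunctions.Zhang2022.Typed.Section17

open Literature.NumberTheory.LFunctions.Zhang2022
open Literature.NumberTheory.LFunctions.Zhang2022.Skeleton

/-! ## §1. Square-free expansion of `∏ (1 + a/p)` and Rankin's split -/

/-- `∏_{p∈S} (1 + a/p) = Σ_{T⊆S} a^{|T|}/∏_{p∈T} p`. [cite: MontgomeryVaughan2007, §7.1] -/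
theorem prod_one_add_div_eq_sum (S : Finset ℕ) (a : ℝ) :
    ∏ p ∈ S, (1 + a / (p : ℝ)) = ∑ T ∈ S.powerset, a ^ T.card / ∏ p ∈ T, ((p : ℕ) : ℝ) := by
  rw [Finset.prod_one_add]
  refine Finset.sum_congr rfl fun T _ => ?_
  rw [Finset.prod_div_distrib, Finset.prod_const]

/-- The product `∏_{p∈T} p` over a set of primes is positive (as a real number). [folklore] -/
private theorem prod_primes_pos {T : Finset ℕ} (hT : ∀ p ∈ T, p.Prime) : 0 < ∏ p ∈ T, ((p : ℕ) : ℝ) :=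
  Finset.prod_pos fun p hp => by exact_mod_cast (hT p hp).pos

/-- **Rankin's split**: for a finite set `S` of primes, `a ≥ 0`, `X > 0`, `σ ≥ 0`,
`∏_{p∈S}(1 + a/p) ≤ Σ_{T⊆S, ∏T<X} a^{|T|}/∏T + X^{−σ}·∏_{p∈S}(1 + a·p^σ/p)`.
[cite: MontgomeryVaughan2007, §7.1 (7.17)] -/
theorem prod_one_add_div_le_sum_add_tail {S : Finset ℕ} (hS : ∀ p ∈ S, p.Prime) {a X σ : ℝ}
    (ha : 0 ≤ a) (hX : 0 < X) (hσ : 0 ≤ σ) :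
    ∏ p ∈ S, (1 + a / (p : ℝ)) ≤
      (∑ T ∈ S.powerset with (∏ p ∈ T, ((p : ℕ) : ℝ)) < X, a ^ T.card / ∏ p ∈ T, ((p : ℕ) : ℝ)) +
        X ^ (-σ) * ∏ p ∈ S, (1 + a * (p : ℝ) ^ σ / p) := by
  classical
  rw [prod_one_add_div_eq_sum,
    ← Finset.sum_filter_add_sum_filter_not S.powerset (fun T => (∏ p ∈ T, ((p : ℕ) : ℝ)) < X)]
  gcongr
  -- the tail `∏T ≥ X`
  have htail : ∀ T ∈ S.powerset.filter (fun T => ¬ (∏ p ∈ T, ((p : ℕ) : ℝ)) < X),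
      a ^ T.card / ∏ p ∈ T, ((p : ℕ) : ℝ) ≤ X ^ (-σ) * (a ^ T.card * (∏ p ∈ T, ((p : ℕ) : ℝ) ^ σ) / ∏ p ∈ T, ((p : ℕ) : ℝ)) := by
    intro T hT
    rw [Finset.mem_filter, Finset.mem_powerset, not_lt] at hT
    have hTp : ∀ p ∈ T, p.Prime := fun p hp => hS p (hT.1 hp)
    have hn : 0 < ∏ p ∈ T, ((p : ℕ) : ℝ) := prod_primes_pos hTp
    have hpow : (∏ p ∈ T, ((p : ℕ) : ℝ) ^ σ) = (∏ p ∈ T, ((p : ℕ) : ℝ)) ^ σ :=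
      Real.finsetProd_rpow T (fun p => (p : ℝ)) (fun p _ => Nat.cast_nonneg p) σ
    have h1 : 1 ≤ X ^ (-σ) * (∏ p ∈ T, ((p : ℕ) : ℝ)) ^ σ := by
      rw [Real.rpow_neg hX.le, ← div_eq_inv_mul, ← Real.div_rpow hn.le hX.le]
      exact Real.one_le_rpow ((one_le_div hX).mpr hT.2) hσ
    rw [hpow]
    calc a ^ T.card / ∏ p ∈ T, ((p : ℕ) : ℝ) = a ^ T.card / (∏ p ∈ T, ((p : ℕ) : ℝ)) * 1 := (mul_one _).symm
      _ ≤ a ^ T.card / (∏ p ∈ T, ((p : ℕ) : ℝ)) * (X ^ (-σ) * (∏ p ∈ T, ((p : ℕ) : ℝ)) ^ σ) :=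
          mul_le_mul_of_nonneg_left h1 (div_nonneg (pow_nonneg ha _) hn.le)
      _ = X ^ (-σ) * (a ^ T.card * (∏ p ∈ T, ((p : ℕ) : ℝ)) ^ σ / ∏ p ∈ T, ((p : ℕ) : ℝ)) := by ring
  have hnonneg : ∀ T ∈ S.powerset,
      0 ≤ X ^ (-σ) * (a ^ T.card * (∏ p ∈ T, ((p : ℕ) : ℝ) ^ σ) / ∏ p ∈ T, ((p : ℕ) : ℝ)) := by
    intro T hT
    rw [Finset.mem_powerset] at hT
    have hTp : ∀ p ∈ T, p.Prime := fun p hp => hS p (hT hp)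
    refine mul_nonneg (Real.rpow_nonneg hX.le _) (div_nonneg (mul_nonneg (pow_nonneg ha _)
      (Finset.prod_nonneg fun p _ => Real.rpow_nonneg (Nat.cast_nonneg p) _)) (prod_primes_pos hTp).le)
  calc ∑ T ∈ S.powerset.filter (fun T => ¬ (∏ p ∈ T, ((p : ℕ) : ℝ)) < X), a ^ T.card / ∏ p ∈ T, ((p : ℕ) : ℝ)
      ≤ ∑ T ∈ S.powerset.filter (fun T => ¬ (∏ p ∈ T, ((p : ℕ) : ℝ)) < X),
          X ^ (-σ) * (a ^ T.card * (∏ p ∈ T, ((p : ℕ) : ℝ) ^ σ) / ∏ p ∈ T, ((p : ℕ) : ℝ)) := Finset.sum_le_sum htail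
    _ ≤ ∑ T ∈ S.powerset, X ^ (-σ) * (a ^ T.card * (∏ p ∈ T, ((p : ℕ) : ℝ) ^ σ) / ∏ p ∈ T, ((p : ℕ) : ℝ)) :=
          Finset.sum_le_sum_of_subset_of_nonneg (Finset.filter_subset _ _) fun T hT _ => hnonneg T hT
    _ = X ^ (-σ) * ∏ p ∈ S, (1 + a * (p : ℝ) ^ σ / p) := by
          rw [← Finset.mul_sum, Finset.prod_one_add]
          congr 1
          refine Finset.sum_congr rfl fun T _ => ?_
          rw [Finset.prod_div_distrib, Finset.prod_mul_distrib, Finset.prod_const]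

/-! ## §2. Perturbing the weights: `∏(1 + a p^σ/p) ≤ ∏(1 + a/p)·exp(a Σ (p^σ − 1)/p)` -/

/-- `e^t − 1 ≤ t·e^t` (all real `t`: `(1 − t)e^t ≤ 1`). [folklore] -/
private theorem exp_sub_one_le_mul_exp (t : ℝ) : Real.exp t - 1 ≤ t * Real.exp t := by
  have h := Real.add_one_le_exp (-t)
  have hpos := Real.exp_pos t
  have : (-t + 1) * Real.exp t ≤ Real.exp (-t) * Real.exp t :=
    mul_le_mul_of_nonneg_right h hpos.le
  rw [← Real.exp_add, neg_add_cancel, Real.exp_zero] at this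
  nlinarith

/-- For `p ≥ 1`: `p^σ − 1 ≤ σ·log p·p^σ`. [folklore] -/
private theorem rpow_sub_one_le_mul {p : ℕ} (hp : 1 ≤ p) (σ : ℝ) :
    (p : ℝ) ^ σ - 1 ≤ σ * Real.log p * (p : ℝ) ^ σ := by
  have hp0 : (0 : ℝ) < p := by exact_mod_cast hp
  rw [Real.rpow_def_of_pos hp0, mul_comm (Real.log p) σ]
  exact exp_sub_one_le_mul_exp _

/-- Termwise: for `a ≥ 0`, `p > 0`, `p^σ ≥ 1`: `1 + a p^σ/p ≤ (1 + a/p)·exp(a (p^σ−1)/p)`. [folklore] -/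
private theorem one_add_mul_rpow_div_le {a : ℝ} (ha : 0 ≤ a) {p : ℕ} (hp : 0 < p) {σ : ℝ} (hσ : 0 ≤ σ) :
    1 + a * (p : ℝ) ^ σ / p ≤ (1 + a / (p : ℝ)) * Real.exp (a * ((p : ℝ) ^ σ - 1) / p) := by
  have hp0 : (0 : ℝ) < p := by exact_mod_cast hp
  have hpσ : 1 ≤ (p : ℝ) ^ σ := Real.one_le_rpow (by exact_mod_cast hp) hσ
  have hv : 0 ≤ a * ((p : ℝ) ^ σ - 1) / p := div_nonneg (mul_nonneg ha (by linarith)) hp0.le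
  have hu : 0 ≤ a / (p : ℝ) := div_nonneg ha hp0.le
  calc 1 + a * (p : ℝ) ^ σ / p = (1 + a / (p : ℝ)) + a * ((p : ℝ) ^ σ - 1) / p := by ring
    _ ≤ (1 + a / (p : ℝ)) * (1 + a * ((p : ℝ) ^ σ - 1) / p) := by nlinarith
    _ ≤ (1 + a / (p : ℝ)) * Real.exp (a * ((p : ℝ) ^ σ - 1) / p) := by
        gcongr
        linarith [Real.add_one_le_exp (a * ((p : ℝ) ^ σ - 1) / p)]

/-- `∏_{p∈S}(1 + a p^σ/p) ≤ ∏_{p∈S}(1 + a/p)·exp(a·Σ_{p∈S}(p^σ−1)/p)` for a set of primes `S`.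
[cite: MontgomeryVaughan2007, §7.1] -/
theorem prod_one_add_mul_rpow_div_le {S : Finset ℕ} (hS : ∀ p ∈ S, p.Prime) {a σ : ℝ} (ha : 0 ≤ a)
    (hσ : 0 ≤ σ) :
    ∏ p ∈ S, (1 + a * (p : ℝ) ^ σ / p) ≤
      (∏ p ∈ S, (1 + a / (p : ℝ))) * Real.exp (a * ∑ p ∈ S, ((p : ℝ) ^ σ - 1) / p) := by
  rw [Finset.mul_sum, Real.exp_sum, ← Finset.prod_mul_distrib]
  refine Finset.prod_le_prod (fun p hp => ?_) fun p hp => ?_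
  · have : (0 : ℝ) < p := by exact_mod_cast (hS p hp).pos
    positivity
  · rw [← mul_div_assoc]
    exact one_add_mul_rpow_div_le ha (hS p hp).pos hσ

/-- The exponent under Mertens I: if every `p ∈ S` is a prime `≤ y` with `p^σ ≤ 3`, then
`Σ_{p∈S}(p^σ−1)/p ≤ 3σ(log y + log 4)`. [cite: MontgomeryVaughan2007, §7.1] -/
theorem sum_rpow_sub_one_div_le {S : Finset ℕ} {y : ℕ} (hS : ∀ p ∈ S, p.Prime ∧ p ≤ y) {σ : ℝ}
    (hσ : 0 ≤ σ) (h3 : ∀ p ∈ S, (p : ℝ) ^ σ ≤ 3) :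
    ∑ p ∈ S, ((p : ℝ) ^ σ - 1) / p ≤ 3 * σ * (Real.log y + Real.log 4) := by
  have hsub : S ⊆ Nat.primesLE y := fun p hp => Nat.mem_primesLE.mpr ⟨(hS p hp).2, (hS p hp).1⟩
  calc ∑ p ∈ S, ((p : ℝ) ^ σ - 1) / p ≤ ∑ p ∈ S, 3 * σ * (Real.log p / p) := by
        refine Finset.sum_le_sum fun p hp => ?_
        have hp1 : 1 ≤ p := (hS p hp).1.one_lt.le
        have hp0 : (0 : ℝ) < p := by exact_mod_cast (hS p hp).1.pos
        have hlog : 0 ≤ Real.log p := Real.log_nonneg (by exact_mod_cast hp1)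
        rw [mul_div_assoc']
        refine div_le_div_of_nonneg_right ?_ hp0.le
        have ht : 0 ≤ σ * Real.log p := mul_nonneg hσ hlog
        calc (p : ℝ) ^ σ - 1 ≤ σ * Real.log p * (p : ℝ) ^ σ := rpow_sub_one_le_mul hp1 σ
          _ ≤ σ * Real.log p * 3 := mul_le_mul_of_nonneg_left (h3 p hp) ht
          _ = 3 * σ * Real.log p := by ring
    _ = 3 * σ * ∑ p ∈ S, Real.log p / p := by rw [Finset.mul_sum]
    _ ≤ 3 * σ * ∑ p ∈ Nat.primesLE y, Real.log p / p := by
        refine mul_le_mul_of_nonneg_left (Finset.sum_le_sum_of_subset_of_nonneg hsub fun p hp _ => ?_)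
          (by positivity)
        have hp' := (Nat.mem_primesLE.mp hp).2
        exact div_nonneg (Real.log_nonneg (by exact_mod_cast hp'.one_lt.le)) (Nat.cast_nonneg p)
    _ ≤ 3 * σ * (Real.log y + Real.log 4) := by
        gcongr
        exact MertensBound.sum_log_div_prime_le y

/-- `∏_{p∈U}(1 + a/p) ≤ exp(a·Σ_{p∈U} 1/p)` (`a ≥ 0`). [folklore] -/
private theorem prod_one_add_div_le_exp (U : Finset ℕ) {a : ℝ} (ha : 0 ≤ a) :
    ∏ p ∈ U, (1 + a / (p : ℝ)) ≤ Real.exp (a * ∑ p ∈ U, (p : ℝ)⁻¹) := by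
  rw [Finset.mul_sum, Real.exp_sum]
  refine Finset.prod_le_prod (fun p _ => by positivity) fun p _ => ?_
  rw [← div_eq_mul_inv]
  linarith [Real.add_one_le_exp (a / (p : ℝ))]

/-! ## §3. `ν` on square-free products of split primes -/

variable {D : ℕ} (χ : DirichletCharacter ℂ D)

/-- `ν = 1 ∗ χ` is the tree's `divisorSumChar`. [cite: Zhang2022LandauSiegel, §3 p.6] -/
theorem nu_eq_divisorSumChar : nu χ = Literature.NumberTheory.LFunctions.divisorSumChar χ := rfl

/-- For a finite set `T` of primes with `χ(p) = 1`: `ν(∏_{p∈T} p) = 2^{|T|}` (`ν = 1 ∗ χ` is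
multiplicative with `ν(p) = 1 + χ(p)`). [cite: Zhang2022LandauSiegel, §3 p.6] -/
theorem nu_prod_splitPrimes {T : Finset ℕ} (hT : ∀ p ∈ T, p.Prime ∧ χ (p : ZMod D) = 1) :
    nu χ (∏ p ∈ T, p) = 2 ^ T.card := by
  classical
  induction T using Finset.induction_on with
  | empty =>
      simp only [Finset.prod_empty, Finset.card_empty, pow_zero]
      have h := Literature.NumberTheory.LFunctions.divisorSumChar_prime_pow χ Nat.prime_two 0
      rw [pow_zero] at h
      rw [nu_eq_divisorSumChar, h]
      simp [Literature.NumberTheory.LFunctions.geomPartialSum]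
  | insert p T hpT ih =>
      have hp := (hT p (Finset.mem_insert_self p T)).1
      have hχp := (hT p (Finset.mem_insert_self p T)).2
      have hT' : ∀ q ∈ T, q.Prime ∧ χ (q : ZMod D) = 1 := fun q hq => hT q (Finset.mem_insert_of_mem hq)
      rw [Finset.prod_insert hpT, Finset.card_insert_of_notMem hpT, pow_succ, mul_comm ((2 : ℂ) ^ _)]
      have hcop : Nat.Coprime p (∏ q ∈ T, q) :=
        Nat.Coprime.prod_right fun q hq => (Nat.coprime_primes hp (hT' q hq).1).mpr
          (fun h => hpT (h ▸ hq))
      rw [nu_eq_divisorSumChar, Literature.NumberTheory.LFunctions.divisorSumChar_mul_of_coprime χ hcop,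
        ← nu_eq_divisorSumChar, ih hT']
      congr 1
      have h1 := Literature.NumberTheory.LFunctions.divisorSumChar_prime_pow χ hp 1
      rw [pow_one] at h1
      rw [nu_eq_divisorSumChar, h1]
      simp [Literature.NumberTheory.LFunctions.geomPartialSum, hχp]

/-- Hence `‖ν(∏_{p∈T} p)‖² = 4^{|T|}` for a set `T` of split primes. [cite: Zhang2022LandauSiegel, §3 p.6] -/
theorem norm_nu_prod_splitPrimes_sq {T : Finset ℕ} (hT : ∀ p ∈ T, p.Prime ∧ χ (p : ZMod D) = 1) :
    ‖nu χ (∏ p ∈ T, p)‖ ^ 2 = 4 ^ T.card := by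
  rw [nu_prod_splitPrimes χ hT, norm_pow]
  norm_num [← pow_mul, pow_mul']

/-- The square-free lower bound behind Lemma 17.1: for a finite set `S` of split primes,
`Σ_{T⊆S, ∏T<D⁴} 4^{|T|}/∏T ≤ Σ_{n<D⁴} ‖ν(n)‖²/n`. [cite: Zhang2022LandauSiegel, §17 Lemma 17.1 p.96] -/
theorem sum_splitPrimes_le_sum_nu_sq {S : Finset ℕ} (hS : ∀ p ∈ S, p.Prime ∧ χ (p : ZMod D) = 1) :
    (∑ T ∈ S.powerset with (∏ p ∈ T, ((p : ℕ) : ℝ)) < (D : ℝ) ^ 4, (4 : ℝ) ^ T.card / ∏ p ∈ T, ((p : ℕ) : ℝ)) ≤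
      ∑ n ∈ Finset.range (D ^ 4), ‖nu χ n‖ ^ 2 / n := by
  classical
  set P : Finset (Finset ℕ) := S.powerset.filter (fun T => (∏ p ∈ T, ((p : ℕ) : ℝ)) < (D : ℝ) ^ 4) with hP
  set f : Finset ℕ → ℕ := fun T => ∏ p ∈ T, p with hf
  have hinj : Set.InjOn f P := by
    intro T₁ h₁ T₂ h₂ h
    have h₁' : ∀ p ∈ T₁, p.Prime := fun p hp =>
      (hS p ((Finset.mem_powerset.mp (Finset.mem_filter.mp h₁).1) hp)).1
    have h₂' : ∀ p ∈ T₂, p.Prime := fun p hp =>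
      (hS p ((Finset.mem_powerset.mp (Finset.mem_filter.mp h₂).1) hp)).1
    have := congrArg Nat.primeFactors h
    rwa [hf, Nat.primeFactors_prod h₁', Nat.primeFactors_prod h₂'] at this
  have himg : P.image f ⊆ Finset.range (D ^ 4) := by
    intro n hn
    obtain ⟨T, hT, rfl⟩ := Finset.mem_image.mp hn
    have hlt := (Finset.mem_filter.mp hT).2
    rw [Finset.mem_range]
    have : ((∏ p ∈ T, p : ℕ) : ℝ) < (D : ℝ) ^ 4 := by rw [Nat.cast_prod]; exact hlt
    exact_mod_cast this
  have hterm : ∀ T ∈ P, (4 : ℝ) ^ T.card / ∏ p ∈ T, ((p : ℕ) : ℝ) = ‖nu χ (f T)‖ ^ 2 / (f T : ℕ) := by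
    intro T hT
    have hT' : ∀ p ∈ T, p.Prime ∧ χ (p : ZMod D) = 1 := fun p hp =>
      hS p ((Finset.mem_powerset.mp (Finset.mem_filter.mp hT).1) hp)
    rw [hf, norm_nu_prod_splitPrimes_sq χ hT', Nat.cast_prod]
  calc (∑ T ∈ P, (4 : ℝ) ^ T.card / ∏ p ∈ T, ((p : ℕ) : ℝ))
      = ∑ T ∈ P, ‖nu χ (f T)‖ ^ 2 / (f T : ℕ) := Finset.sum_congr rfl hterm
    _ = ∑ n ∈ P.image f, ‖nu χ n‖ ^ 2 / n := by rw [Finset.sum_image hinj]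
    _ ≤ ∑ n ∈ Finset.range (D ^ 4), ‖nu χ n‖ ^ 2 / n :=
        Finset.sum_le_sum_of_subset_of_nonneg himg fun n _ _ => by positivity

/-! ## §4. Thresholds -/

/-- `⌈exp L₀⌉ ≤ D` gives `L₀ ≤ log D`. [folklore] -/
private theorem le_log_of_ceil_exp_le {L₀ : ℝ} {D : ℕ} (hD : ⌈Real.exp L₀⌉₊ ≤ D) : L₀ ≤ Real.log D := by
  have h1 : Real.exp L₀ ≤ D := le_trans (Nat.le_ceil _) (by exact_mod_cast hD)
  have hD0 : (0 : ℝ) < D := lt_of_lt_of_le (Real.exp_pos _) h1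
  rw [Real.le_log_iff_exp_le hD0]
  exact h1

/-! ## §5. The split-prime product is `O(𝔞 + 1)` -/

/-- **`∏_{p<D⁴, χ(p)=1}(1 + 4/p) ≤ C·(𝔞 + 1)` for all large `D` under (A)** (`C = 2·20⁴e⁴`). The
Hall–Tenenbaum constant of every `F₁`-type outer count of the §17.u021 remainders (prime weight `4` at the
split primes, `0` at `χ(p) = −1`), in the relative currency of RT16-int-4.
[cite: Zhang2022LandauSiegel, §17 u021 p.98; Lemma 17.1 p.96] -/
theorem prod_splitPrimes_le_frakA : ∃ C : ℝ, ForAllLarge fun D _ χ => AssumptionA D χ →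
    ∏ p ∈ (Finset.range (D ^ 4)).filter (fun p : ℕ => p.Prime ∧ χ (p : ZMod D) = 1), (1 + 4 / (p : ℝ)) ≤
      C * (frakA χ + 1) := by
  classical
  obtain ⟨C₁₇, h17⟩ := appBLemma171_holds
  obtain ⟨D₁₇, h17⟩ := h17
  set K₂ : ℝ := Real.exp (4 * (Real.log 20 + 1)) with hK₂
  refine ⟨2 * K₂, max D₁₇ (⌈Real.exp (max 80 (max C₁₇ 1))⌉₊), fun D _ χ hD hq hp hA => ?_⟩
  have hD₁₇ : D₁₇ ≤ D := le_trans (le_max_left _ _) hD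
  have hL : max 80 (max C₁₇ 1) ≤ Real.log D := le_log_of_ceil_exp_le (le_trans (le_max_right _ _) hD)
  have hL80 : 80 ≤ Real.log D := le_trans (le_max_left _ _) hL
  have hLC : C₁₇ ≤ Real.log D := le_trans (le_trans (le_max_left _ _) (le_max_right _ _)) hL
  have hL1 : 1 ≤ Real.log D := le_trans (le_trans (le_max_right _ _) (le_max_right _ _)) hL
  have hL0 : 0 < Real.log D := by linarith
  have hD1 : (1 : ℝ) < D := by
    by_contra h
    push Not at h
    have := Real.log_nonpos (Nat.cast_nonneg D) h
    linarith
  have hD0 : (0 : ℝ) < D := by linarith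
  -- Lemma 17.1: `Σ_{n<D⁴} ‖ν n‖²/n ≤ 𝔞 + 1`
  have hA17 : ∑ n ∈ Finset.range (D ^ 4), ‖nu χ n‖ ^ 2 / n ≤ frakA χ + 1 := by
    have h := h17 D χ hD₁₇ hq hp hA
    have hell : ell D = Real.log D := rfl
    have h1 : C₁₇ / ell D ^ 2011 ≤ 1 := by
      rw [hell]
      rcases le_or_gt C₁₇ 0 with hC | hC
      · exact le_trans (div_nonpos_of_nonpos_of_nonneg hC (by positivity)) zero_le_one
      · rw [div_le_one (by positivity)]
        calc C₁₇ ≤ Real.log D := hLC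
          _ = Real.log D ^ 1 := (pow_one _).symm
          _ ≤ Real.log D ^ 2011 := pow_le_pow_right₀ hL1 (by norm_num)
    have := (abs_le.mp h).2
    linarith
  -- the two sets of split primes
  set A : Finset ℕ := (Finset.range (D ^ 4)).filter (fun p : ℕ => p.Prime ∧ χ (p : ZMod D) = 1) with hAdef
  set S : Finset ℕ := A.filter (fun p : ℕ => p ^ 5 ≤ D) with hSdef
  set U : Finset ℕ := A.filter (fun p : ℕ => ¬ p ^ 5 ≤ D) with hUdef
  have hsplit : ∏ p ∈ A, (1 + 4 / (p : ℝ)) = (∏ p ∈ S, (1 + 4 / (p : ℝ))) * ∏ p ∈ U, (1 + 4 / (p : ℝ)) :=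
    (Finset.prod_filter_mul_prod_filter_not A (fun p : ℕ => p ^ 5 ≤ D) _).symm
  have hSprime : ∀ p ∈ S, p.Prime := fun p hp =>
    (Finset.mem_filter.mp (Finset.mem_filter.mp hp).1).2.1
  have hSsplit : ∀ p ∈ S, p.Prime ∧ χ (p : ZMod D) = 1 := fun p hp =>
    (Finset.mem_filter.mp (Finset.mem_filter.mp hp).1).2
  have hS5 : ∀ p ∈ S, p ^ 5 ≤ D := fun p hp => (Finset.mem_filter.mp hp).2
  -- §5a. The small split primes: Rankin at `σ = 5/log D`, `X = D⁴`
  set σ : ℝ := 5 / Real.log D with hσdef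
  have hσ0 : 0 ≤ σ := div_nonneg (by norm_num) hL0.le
  set X : ℝ := (D : ℝ) ^ 4 with hXdef
  have hX0 : 0 < X := by positivity
  have hR := prod_one_add_div_le_sum_add_tail hSprime (by norm_num : (0 : ℝ) ≤ 4) hX0 hσ0
  -- `X^{-σ} = e^{-20}`
  have hXσ : X ^ (-σ) = Real.exp (-20) := by
    rw [hXdef, ← Real.rpow_natCast, ← Real.rpow_mul hD0.le, Real.rpow_def_of_pos hD0, hσdef]
    congr 1
    field_simp
    ring
  -- `p^σ ≤ 3` on `S`
  have h3 : ∀ p ∈ S, (p : ℝ) ^ σ ≤ 3 := by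
    intro p hp
    have hpP := hSprime p hp
    have hp0 : (0 : ℝ) < p := by exact_mod_cast hpP.pos
    have h5 : 5 * Real.log p ≤ Real.log D := by
      have : ((p ^ 5 : ℕ) : ℝ) ≤ D := by exact_mod_cast hS5 p hp
      have := Real.log_le_log (by exact_mod_cast pow_pos hpP.pos 5) this
      rwa [Nat.cast_pow, Real.log_pow, Nat.cast_ofNat] at this
    rw [Real.rpow_def_of_pos hp0, hσdef]
    calc Real.exp (Real.log p * (5 / Real.log D)) ≤ Real.exp 1 := by
          apply Real.exp_le_exp.mpr
          rw [mul_div_assoc', div_le_one hL0]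
          linarith
      _ ≤ 3 := by linarith [Real.exp_one_lt_d9]
  -- `S ⊆ primesLE y`, `y = ⌊D^{1/5}⌋`, and `log y ≤ log D / 5`
  set y : ℕ := ⌊(D : ℝ) ^ ((1 : ℝ) / 5)⌋₊ with hydef
  have hyD : Real.log y ≤ Real.log D / 5 := by
    rcases Nat.eq_zero_or_pos y with hy0 | hy0
    · rw [hy0, Nat.cast_zero, Real.log_zero]; positivity
    · have h1 : (y : ℝ) ≤ (D : ℝ) ^ ((1 : ℝ) / 5) := Nat.floor_le (Real.rpow_nonneg hD0.le _)
      have := Real.log_le_log (by exact_mod_cast hy0) h1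
      rwa [Real.log_rpow hD0, one_div_mul_eq_div] at this
  have hSy : ∀ p ∈ S, p.Prime ∧ p ≤ y := by
    intro p hp
    refine ⟨hSprime p hp, ?_⟩
    rw [hydef]
    apply Nat.le_floor
    have hp0 : (0 : ℝ) ≤ p := Nat.cast_nonneg p
    have h5 : ((p : ℝ) ^ (5 : ℕ)) ≤ D := by exact_mod_cast hS5 p hp
    calc (p : ℝ) = ((p : ℝ) ^ (5 : ℕ)) ^ ((1 : ℝ) / 5) := by
          rw [← Real.rpow_natCast, ← Real.rpow_mul hp0]; norm_num
      _ ≤ (D : ℝ) ^ ((1 : ℝ) / 5) := Real.rpow_le_rpow (by positivity) h5 (by norm_num)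
  have hexp : ∑ p ∈ S, ((p : ℝ) ^ σ - 1) / p ≤ 9 / 2 := by
    have hσL : σ * (Real.log D / 5) = 1 := by rw [hσdef]; field_simp
    have h4 : Real.log 4 ≤ 4 := by
      have := Real.log_le_sub_one_of_pos (by norm_num : (0 : ℝ) < 4); linarith
    have hσle : σ ≤ 5 / 80 := by
      rw [hσdef]; exact div_le_div_of_nonneg_left (by norm_num) (by norm_num) hL80
    have hσ4 : σ * Real.log 4 ≤ 1 / 2 := by
      have h40 : 0 ≤ Real.log 4 := Real.log_nonneg (by norm_num)
      nlinarith
    calc ∑ p ∈ S, ((p : ℝ) ^ σ - 1) / p ≤ 3 * σ * (Real.log y + Real.log 4) :=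
          sum_rpow_sub_one_div_le hSy hσ0 h3
      _ ≤ 3 * σ * (Real.log D / 5 + Real.log 4) := by gcongr
      _ = 3 * (σ * (Real.log D / 5) + σ * Real.log 4) := by ring
      _ ≤ 3 * (1 + 1 / 2) := by rw [hσL]; linarith
      _ = 9 / 2 := by norm_num
  -- the tail is at most half of the product
  have htail : X ^ (-σ) * ∏ p ∈ S, (1 + 4 * (p : ℝ) ^ σ / p) ≤ (1 / 2) * ∏ p ∈ S, (1 + 4 / (p : ℝ)) := by
    have hprod0 : 0 ≤ ∏ p ∈ S, (1 + 4 / (p : ℝ)) := Finset.prod_nonneg fun p _ => by positivity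
    calc X ^ (-σ) * ∏ p ∈ S, (1 + 4 * (p : ℝ) ^ σ / p)
        ≤ X ^ (-σ) * ((∏ p ∈ S, (1 + 4 / (p : ℝ))) * Real.exp (4 * ∑ p ∈ S, ((p : ℝ) ^ σ - 1) / p)) :=
          mul_le_mul_of_nonneg_left (prod_one_add_mul_rpow_div_le hSprime (by norm_num) hσ0)
            (Real.rpow_nonneg hX0.le _)
      _ ≤ Real.exp (-20) * ((∏ p ∈ S, (1 + 4 / (p : ℝ))) * Real.exp (4 * (9 / 2))) := by
          rw [hXσ]; gcongr
      _ = (Real.exp (-20) * Real.exp (4 * (9 / 2))) * ∏ p ∈ S, (1 + 4 / (p : ℝ)) := by ring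
      _ = Real.exp (-2) * ∏ p ∈ S, (1 + 4 / (p : ℝ)) := by
          rw [← Real.exp_add]; norm_num
      _ ≤ (1 / 2) * ∏ p ∈ S, (1 + 4 / (p : ℝ)) := by
          gcongr
          rw [Real.exp_neg, inv_le_comm₀ (Real.exp_pos 2) (by norm_num)]
          have := Real.add_one_le_exp (2 : ℝ)
          norm_num at this ⊢
          linarith
  have hSle : ∏ p ∈ S, (1 + 4 / (p : ℝ)) ≤ 2 * (frakA χ + 1) := by
    have h1 := hR
    have h2 := sum_splitPrimes_le_sum_nu_sq χ hSsplit
    rw [← hXdef] at h2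
    linarith
  -- §5b. The large split primes `D^{1/5} < p < D⁴`: windowed Mertens
  have hUle : ∏ p ∈ U, (1 + 4 / (p : ℝ)) ≤ K₂ := by
    have hy2 : (2 : ℝ) ≤ (D : ℝ) ^ ((1 : ℝ) / 5) := by
      have h32 : (32 : ℝ) ≤ D := by
        have := Real.add_one_le_exp (Real.log D)
        rw [Real.exp_log hD0] at this
        linarith
      calc (2 : ℝ) = ((32 : ℝ)) ^ ((1 : ℝ) / 5) := by
            rw [show (32 : ℝ) = 2 ^ (5 : ℕ) by norm_num, ← Real.rpow_natCast, ← Real.rpow_mul (by norm_num)]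
            norm_num
        _ ≤ (D : ℝ) ^ ((1 : ℝ) / 5) := Real.rpow_le_rpow (by norm_num) h32 (by norm_num)
    have hyX : (D : ℝ) ^ ((1 : ℝ) / 5) ≤ X := by
      rw [hXdef, ← Real.rpow_natCast]
      exact Real.rpow_le_rpow_of_exponent_le hD1.le (by norm_num)
    have hW := SelbergPrimes.sum_inv_primes_window_le hy2 hyX
    have hUsub : U ⊆ (Nat.primesLE ⌊X⌋₊).filter (fun p : ℕ => (D : ℝ) ^ ((1 : ℝ) / 5) < (p : ℝ)) := by
      intro p hp
      have hpA := (Finset.mem_filter.mp hp).1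
      have hp5 := (Finset.mem_filter.mp hp).2
      have hpP := (Finset.mem_filter.mp hpA).2.1
      have hplt : p < D ^ 4 := Finset.mem_range.mp (Finset.mem_filter.mp hpA).1
      refine Finset.mem_filter.mpr ⟨Nat.mem_primesLE.mpr ⟨?_, hpP⟩, ?_⟩
      · rw [hXdef, ← Nat.cast_pow, Nat.floor_natCast]; exact hplt.le
      · by_contra h
        push Not at h
        apply hp5
        have hp0 : (0 : ℝ) ≤ p := Nat.cast_nonneg p
        have : (p : ℝ) ^ (5 : ℕ) ≤ D := by
          calc (p : ℝ) ^ (5 : ℕ) = ((p : ℝ) ^ (5 : ℝ)) := (Real.rpow_natCast _ 5).symm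
            _ ≤ ((D : ℝ) ^ ((1 : ℝ) / 5)) ^ (5 : ℝ) := Real.rpow_le_rpow hp0 h (by norm_num)
            _ = D := by rw [← Real.rpow_mul hD0.le]; norm_num
        exact_mod_cast this
    have hlog : Real.log (Real.log X) - Real.log (Real.log ((D : ℝ) ^ ((1 : ℝ) / 5))) = Real.log 20 := by
      rw [hXdef, ← Real.rpow_natCast, Real.log_rpow hD0, Real.log_rpow hD0, Real.log_mul (by norm_num) hL0.ne',
        Real.log_mul (by norm_num) hL0.ne']
      have : Real.log (20 : ℝ) = Real.log 4 - Real.log ((1 : ℝ) / 5) := by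
        rw [← Real.log_div (by norm_num) (by norm_num)]; norm_num
      rw [this]; push_cast; ring
    have h16 : 16 / Real.log ((D : ℝ) ^ ((1 : ℝ) / 5)) ≤ 1 := by
      rw [Real.log_rpow hD0, div_le_one (by positivity)]
      linarith
    calc ∏ p ∈ U, (1 + 4 / (p : ℝ)) ≤ Real.exp (4 * ∑ p ∈ U, (p : ℝ)⁻¹) := prod_one_add_div_le_exp U (by norm_num)
      _ ≤ Real.exp (4 * ∑ p ∈ (Nat.primesLE ⌊X⌋₊).filter (fun p : ℕ => (D : ℝ) ^ ((1 : ℝ) / 5) < (p : ℝ)),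
            (p : ℝ)⁻¹) :=
          Real.exp_le_exp.mpr (mul_le_mul_of_nonneg_left
            (Finset.sum_le_sum_of_subset_of_nonneg hUsub fun p _ _ => by positivity) (by norm_num))
      _ ≤ Real.exp (4 * (Real.log 20 + 1)) := by
          gcongr
          linarith
      _ = K₂ := rfl
  -- §5c. Assembly
  have hA0 : 0 ≤ frakA χ + 1 := by linarith [frakA_nonneg χ]
  have hK₂0 : 0 ≤ K₂ := (Real.exp_pos _).le
  have hS0 : 0 ≤ ∏ p ∈ S, (1 + 4 / (p : ℝ)) := Finset.prod_nonneg fun p _ => by positivity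
  rw [hsplit]
  have hU0 : 0 ≤ ∏ p ∈ U, (1 + 4 / (p : ℝ)) := Finset.prod_nonneg fun p _ => by positivity
  have h2A : 0 ≤ 2 * (frakA χ + 1) := by positivity
  calc (∏ p ∈ S, (1 + 4 / (p : ℝ))) * ∏ p ∈ U, (1 + 4 / (p : ℝ))
      ≤ (2 * (frakA χ + 1)) * K₂ := mul_le_mul hSle hUle hU0 h2A
    _ = 2 * K₂ * (frakA χ + 1) := by ring

end Literature.NumberTheory.LFunctions.Zhang2022.Typed.Section17
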